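import Mathlib
import HarnessLib
import Summits.Parity.GeneralizedHardyLittlewood.Theses.LiouvilleMAD
import Summits.Parity.GeneralizedHardyLittlewood.Theorems.DilatedChowla.Negative.DilatedChowlaWelch

/-!
# `FanDecorrelation` (stmt-Parity-13318): the exclusion `k ≠ 0` is load-bearing; `c = 0` is not degenerate

Negative lemmas (load-bearing record) for the crux `LiouvilleMAD.FanDecorrelation` (route
LiouvilleMAD, rank 3), by the crux disprover.  Notation: `Q = ⌊√M⌋ + 1`, `L z = λ(z.toNat)` and
`S c n n' M = Σ_{m∈(M,2M]} λ(mn+c)λ(mn'+c)` from the sibling crux's landed files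
(`DilatedTableChowlaBlocks.L`, `DilatedChowlaMirrorDefs.S`), and the FAN SUM
`R_k(c,n,n';M) = Σ_{j∈[Q,2Q)} Σ_{(m,m')∈(M,2M]², m−m'=kj} λ(mn+c)λ(m'n'+c)`; the crux reads
`|R_k| ≤ C·M^{3/4+ϑ}` for some `ϑ < 1/4`, all `1 ≤ n ≠ n' ≤ 2M`, `k ≠ 0`.  This file declares no
definitions: every statement is written on the crux's verbatim sums.

* `fan_zero_eq`: at `k = 0` the lag filter is the diagonal, `R_0 = Q · S c n n' M`.
* `fanDecorrelation_false_without_kNeZero`: the crux with `k ≠ 0` dropped is FALSE — the Welch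
  floor `|S 1 n n' M| ≥ √(M/2)` for some `n ≠ n'` (`exists_abs_S_ge_sqrt`, sibling Negative file)
  makes `|R_0| ≥ M/√2 > C·M^{3/4+ϑ}`.  So any proof of the crux must use `k ≠ 0`.
* `fan_zero_shift`: at `c = 0` the summand factorises, `R_k(0,n,n') = λ(n)λ(n')·R_k(λ)` with
  `R_k(λ)` the plain-`λ` window sum (the crux's own model object): `c ≠ 0` removes no diagonal from
  a fan (contrast the coset crux) — information for the prover.
* `proportional_lag_small`: the unique fully biased (proportional-form) lag `h` has `|h| ≤ |c|`,
  hence lies below `Q` once `M > c²` — never inside the fan. [folklore]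
-/

noncomputable section

namespace Summit.Parity.GeneralizedHardyLittlewood.Theorems.FanDecorrelation.Negative

open Summit.Parity.GeneralizedHardyLittlewood.Theorems.DilatedTableChowla.Negative
  (L L_natCast L_natCast_mul)
open Summit.Parity.GeneralizedHardyLittlewood.Theorems.DilatedChowla.Negative
  (S exists_abs_S_ge_sqrt)
open Finset Filter

/-! ## §0 Two elementary facts -/

/-- `√M ≤ Q = ⌊√M⌋ + 1`. -/
theorem sqrt_le_natSqrt_add_one (M : ℕ) : Real.sqrt M ≤ (Nat.sqrt M : ℝ) + 1 := by
  have h : M < (Nat.sqrt M + 1) * (Nat.sqrt M + 1) := Nat.lt_succ_sqrt M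
  have h' : (M : ℝ) ≤ ((Nat.sqrt M : ℝ) + 1) ^ 2 := by
    have h'' : ((M : ℕ) : ℝ) < ((Nat.sqrt M + 1 : ℕ) : ℝ) * ((Nat.sqrt M + 1 : ℕ) : ℝ) := by
      exact_mod_cast h
    push_cast at h''
    nlinarith
  calc Real.sqrt M ≤ Real.sqrt (((Nat.sqrt M : ℝ) + 1) ^ 2) := Real.sqrt_le_sqrt h'
    _ = (Nat.sqrt M : ℝ) + 1 := Real.sqrt_sq (by positivity)

/-- At `k = 0` the lag filter is the diagonal of `(M,2M]²`. -/
theorem filter_lag_zero (M j : ℕ) :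
    (Ioc M (2 * M) ×ˢ Ioc M (2 * M)).filter (fun p : ℕ × ℕ => (p.1 : ℤ) - p.2 = 0 * (j : ℤ)) =
      (Ioc M (2 * M)).diag := by
  ext p
  simp only [mem_filter, mem_product, mem_diag, zero_mul, sub_eq_zero, Nat.cast_inj]
  constructor
  · rintro ⟨⟨h1, _⟩, h⟩
    exact ⟨h1, h⟩
  · rintro ⟨h1, h⟩
    exact ⟨⟨h1, h ▸ h1⟩, h⟩

/-! ## §1 `k ≠ 0` is load-bearing -/

/-- **The `k = 0` fan is `Q` copies of the dilated Chowla sum**: `R_0 = Q · S c n n' M`. -/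
theorem fan_zero_eq (c : ℤ) (n n' M : ℕ) :
    (∑ j ∈ Finset.Ico (Nat.sqrt M + 1) (2 * (Nat.sqrt M + 1)),
        ∑ p ∈ (Finset.Ioc M (2 * M) ×ˢ Finset.Ioc M (2 * M)).filter
            (fun p : ℕ × ℕ => (p.1 : ℤ) - p.2 = 0 * (j : ℤ)),
          (ArithmeticFunction.liouville (Int.toNat ((p.1 : ℤ) * n + c)) : ℝ) *
            (ArithmeticFunction.liouville (Int.toNat ((p.2 : ℤ) * n' + c)) : ℝ)) =
      ((Nat.sqrt M : ℝ) + 1) * S c n n' M := by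
  have hin : ∀ j ∈ Ico (Nat.sqrt M + 1) (2 * (Nat.sqrt M + 1)),
      ∑ p ∈ (Ioc M (2 * M) ×ˢ Ioc M (2 * M)).filter
          (fun p : ℕ × ℕ => (p.1 : ℤ) - p.2 = 0 * (j : ℤ)),
        (ArithmeticFunction.liouville (Int.toNat ((p.1 : ℤ) * n + c)) : ℝ) *
          (ArithmeticFunction.liouville (Int.toNat ((p.2 : ℤ) * n' + c)) : ℝ) =
      ∑ m ∈ Ioc M (2 * M), (ArithmeticFunction.liouville (Int.toNat ((m : ℤ) * n + c)) : ℝ) *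
          (ArithmeticFunction.liouville (Int.toNat ((m : ℤ) * n' + c)) : ℝ) := by
    intro j _
    rw [filter_lag_zero, sum_diag]
  have hcard : (Ico (Nat.sqrt M + 1) (2 * (Nat.sqrt M + 1))).card = Nat.sqrt M + 1 := by
    rw [Nat.card_Ico]; omega
  rw [sum_congr rfl hin, sum_const, hcard, nsmul_eq_mul]
  unfold S L
  push_cast
  ring

/-- **`k ≠ 0` is load-bearing** ("any proof must use `k ≠ 0`"): the crux
`LiouvilleMAD.FanDecorrelation` with the hypothesis `k ≠ 0` DROPPED (everything else verbatim) is
false.  Witness `c = 1`, `k = 0`: `R_0 = Q·S 1 n n' M` (`fan_zero_eq`), and by the Welch floor of the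
sibling crux (`exists_abs_S_ge_sqrt`) every `M ≥ 2` has a pair `1 ≤ n ≠ n' ≤ 2M` with
`|S 1 n n' M| ≥ √(M/2)`, so `|R_0| ≥ Q√(M/2) ≥ M/√2`, while `C·M^{3/4+ϑ} ≤ |C|·M^{a}`,
`a = max(3/4+ϑ, 1/2) < 1` — impossible once `M^{1−a} > √2|C|`. [folklore] -/
theorem fanDecorrelation_false_without_kNeZero :
    ¬ (∀ c : ℤ, c ≠ 0 → ∃ ϑ : ℝ, ϑ < 1 / 4 ∧ ∃ C : ℝ, ∀ M n n' : ℕ, ∀ k : ℤ,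
        1 ≤ n → 1 ≤ n' → n ≠ n' → n ≤ 2 * M → n' ≤ 2 * M →
          |∑ j ∈ Finset.Ico (Nat.sqrt M + 1) (2 * (Nat.sqrt M + 1)),
              ∑ p ∈ (Finset.Ioc M (2 * M) ×ˢ Finset.Ioc M (2 * M)).filter
                  (fun p : ℕ × ℕ => (p.1 : ℤ) - p.2 = k * (j : ℤ)),
                (ArithmeticFunction.liouville (Int.toNat ((p.1 : ℤ) * n + c)) : ℝ) *
                  (ArithmeticFunction.liouville (Int.toNat ((p.2 : ℤ) * n' + c)) : ℝ)| ≤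
            C * (M : ℝ) ^ (3 / 4 + ϑ)) := by
  intro h
  obtain ⟨ϑ, hϑ, C, hC⟩ := h 1 one_ne_zero
  set a : ℝ := max (3 / 4 + ϑ) (1 / 2) with ha_def
  have ha1 : a < 1 := max_lt (by linarith) (by norm_num)
  have hε : 0 < 1 - a := by linarith
  have ht : Tendsto (fun M : ℕ => (M : ℝ) ^ (1 - a)) atTop atTop :=
    (tendsto_rpow_atTop hε).comp tendsto_natCast_atTop_atTop
  obtain ⟨M, hM2, hMC⟩ :=
    ((eventually_ge_atTop 2).and (ht.eventually_gt_atTop (Real.sqrt 2 * |C|))).exists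
  have hM2' : (2 : ℝ) ≤ M := by exact_mod_cast hM2
  have hx : (0 : ℝ) < M := by linarith
  have hx1 : (1 : ℝ) ≤ M := by linarith
  have habs : (|(1 : ℤ)| : ℝ) < M := by norm_num; linarith
  obtain ⟨n, n', hn, hn', hne, hn2, hn2', hle⟩ := exists_abs_S_ge_sqrt 1 M habs
  have key := hC M n n' 0 hn hn' hne hn2 hn2'
  rw [fan_zero_eq, abs_mul, abs_of_pos (by positivity : (0 : ℝ) < (Nat.sqrt M : ℝ) + 1)] at key
  -- lower bound `M/√2 ≤ Q·|S|`
  have hlow : Real.sqrt M * Real.sqrt ((M : ℝ) / 2) ≤ ((Nat.sqrt M : ℝ) + 1) * |S 1 n n' M| :=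
    mul_le_mul (sqrt_le_natSqrt_add_one M) hle (Real.sqrt_nonneg _) (by positivity)
  have hprod : Real.sqrt M * Real.sqrt ((M : ℝ) / 2) = (M : ℝ) / Real.sqrt 2 := by
    rw [← Real.sqrt_mul hx.le, show (M : ℝ) * (M / 2) = M ^ 2 / 2 by ring,
      Real.sqrt_div (by positivity) 2, Real.sqrt_sq hx.le]
  -- upper bound `C·M^{3/4+ϑ} ≤ |C|·M^a`
  have hup : C * (M : ℝ) ^ (3 / 4 + ϑ) ≤ |C| * (M : ℝ) ^ a :=
    calc C * (M : ℝ) ^ (3 / 4 + ϑ) ≤ |C| * (M : ℝ) ^ (3 / 4 + ϑ) :=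
          mul_le_mul_of_nonneg_right (le_abs_self C) (by positivity)
      _ ≤ |C| * (M : ℝ) ^ a :=
          mul_le_mul_of_nonneg_left
            (Real.rpow_le_rpow_of_exponent_le hx1 (le_max_left _ _)) (abs_nonneg C)
  have h1 : (M : ℝ) / Real.sqrt 2 ≤ |C| * (M : ℝ) ^ a := by
    rw [← hprod]; exact hlow.trans (key.trans hup)
  have hsplit : (M : ℝ) = (M : ℝ) ^ a * (M : ℝ) ^ (1 - a) := by
    rw [← Real.rpow_add hx, show a + (1 - a) = 1 by ring, Real.rpow_one]
  have hpos : (0 : ℝ) < (M : ℝ) ^ a := Real.rpow_pos_of_pos hx a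
  have h1' : (M : ℝ) ^ a * (M : ℝ) ^ (1 - a) ≤ (M : ℝ) ^ a * (Real.sqrt 2 * |C|) :=
    calc (M : ℝ) ^ a * (M : ℝ) ^ (1 - a) = (M : ℝ) := hsplit.symm
      _ ≤ |C| * (M : ℝ) ^ a * Real.sqrt 2 := (div_le_iff₀ (Real.sqrt_pos.mpr two_pos)).mp h1
      _ = (M : ℝ) ^ a * (Real.sqrt 2 * |C|) := by ring
  have h2 : (M : ℝ) ^ (1 - a) ≤ Real.sqrt 2 * |C| := le_of_mul_le_mul_left h1' hpos
  linarith

/-! ## §2 `c = 0` is not a degenerate case for fans -/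

/-- **At `c = 0` the summand factorises** (complete multiplicativity): the fan sum at shift `0` is
`λ(n)λ(n')` times the plain-`λ` window sum `Σ_{j∈[Q,2Q)} Σ_{m−m'=kj} λ(m)λ(m')` — the crux's own
model object (the instance `(c,n,n') = (2,1,2)` of the crux is `−Σ_j Σ_u λ(u)λ(u+kj+1)`), so dropping
`c ≠ 0` removes no diagonal from a fan and adds nothing degenerate. [folklore] -/
theorem fan_zero_shift (n n' M : ℕ) (k : ℤ) :
    (∑ j ∈ Finset.Ico (Nat.sqrt M + 1) (2 * (Nat.sqrt M + 1)),
        ∑ p ∈ (Finset.Ioc M (2 * M) ×ˢ Finset.Ioc M (2 * M)).filter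
            (fun p : ℕ × ℕ => (p.1 : ℤ) - p.2 = k * (j : ℤ)),
          (ArithmeticFunction.liouville (Int.toNat ((p.1 : ℤ) * n + 0)) : ℝ) *
            (ArithmeticFunction.liouville (Int.toNat ((p.2 : ℤ) * n' + 0)) : ℝ)) =
      (ArithmeticFunction.liouville n : ℝ) * (ArithmeticFunction.liouville n' : ℝ) *
        ∑ j ∈ Finset.Ico (Nat.sqrt M + 1) (2 * (Nat.sqrt M + 1)),
          ∑ p ∈ (Finset.Ioc M (2 * M) ×ˢ Finset.Ioc M (2 * M)).filter
              (fun p : ℕ × ℕ => (p.1 : ℤ) - p.2 = k * (j : ℤ)),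
            (ArithmeticFunction.liouville p.1 : ℝ) * (ArithmeticFunction.liouville p.2 : ℝ) := by
  rw [mul_sum]
  refine sum_congr rfl fun j _ => ?_
  rw [mul_sum]
  refine sum_congr rfl fun p _ => ?_
  have h1 : (ArithmeticFunction.liouville (Int.toNat ((p.1 : ℤ) * n + 0)) : ℝ) =
      (ArithmeticFunction.liouville p.1 : ℝ) * (ArithmeticFunction.liouville n : ℝ) := by
    have h := L_natCast_mul p.1 n
    rw [L_natCast, L_natCast] at h
    rw [add_zero]
    exact h
  have h2 : (ArithmeticFunction.liouville (Int.toNat ((p.2 : ℤ) * n' + 0)) : ℝ) =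
      (ArithmeticFunction.liouville p.2 : ℝ) * (ArithmeticFunction.liouville n' : ℝ) := by
    have h := L_natCast_mul p.2 n'
    rw [L_natCast, L_natCast] at h
    rw [add_zero]
    exact h
  rw [h1, h2]
  ring

/-! ## §3 Statement hygiene: no proportional lag inside the fan -/

/-- **No fully biased lag in the fan.**  If the two linear forms `m' ↦ (m'+h)·n + c` and
`m' ↦ m'·n' + c` are proportional with ratio `t` (the only way `λ((m'+h)n+c)·λ(m'n'+c) = λ(t)` for
ALL `m'`), i.e. `n = t·n'` and `h·n = c·(t−1)`, then `|h| ≤ |c|`: for `M > c²` such a lag is `< Q`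
and never of the form `k·j`, `j ∈ [Q,2Q)`, `k ≠ 0`. [folklore] -/
theorem proportional_lag_small {n n' t h c : ℤ} (hn' : 1 ≤ n') (ht : n = t * n') (hn : 1 ≤ n)
    (hprop : h * n = c * (t - 1)) : |h| ≤ |c| := by
  have ht1 : 1 ≤ t := by nlinarith
  have key : |h| * n = |c| * (t - 1) := by
    have := congrArg abs hprop
    rwa [abs_mul, abs_mul, abs_of_pos (by linarith : (0 : ℤ) < n),
      abs_of_nonneg (by linarith : (0 : ℤ) ≤ t - 1)] at this
  have hn_ge : t ≤ n := by nlinarith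
  nlinarith [abs_nonneg h, abs_nonneg c]

end Summit.Parity.GeneralizedHardyLittlewood.Theorems.FanDecorrelation.Negative

end
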